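import Mathlib.RingTheory.Localization.Module
import Mathlib.RingTheory.Algebraic.Integral
import Summits.BirchSwinnertonDyer.BirchSwinnertonDyer.Theorems.ResidualThetaTransportAtTwoResidualSignedLambdaLowerCMAtTwoFourTermDuality
import HarnessLib

/-!
# (C1) COEFFICIENT DESCENT for λ-counts: `dim_F (F ⊗_R M) = [K:F] · dim_K (K ⊗_A M)` for an algebraic extension of domains `R → A`
# (here `ℤ₂ → 𝒪`), and the N5 duality bound with data typed over the SMALL ring `R` and conclusion over `A`

Route `ResidualThetaTransportAtTwo` (RTT), crux RSL_g `ResidualSignedLambdaLowerCMAtTwo` (stmt-BirchSwinnertonDyer-22608); seat `prover-bsd-wall-rtt-p2` g17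
(`--supports`, closes nothing). THEOREMS ONLY (no definition, no named fact, no instance, no `sorry`); pure commutative algebra over Mathlib +
the landed N5 file `…FourTermDuality` (p664041). BSD is not proved by any of this; RSL_g is not proved here.

-- adapted from `Cruxes/ResidualThetaCountLowerPureAtTwo/Sketch_sidea_k3_g6.lean` (stub-ideation k3 g6, «ℤ₂-descent cut», kernel-checked there;
-- STUB-PLAN rev 11 currency (C1) of SKELETON-V2-CUT-g16: «the rank-restriction identity, one helper, S-sized, lead»): the namespace is moved
-- under `Theorems.CharIdealLambda.IntDescent`, `import Mathlib` is narrowed; statements and proofs unchanged.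

WHY. In the one-pair cut of the 22608 line the compact local side at `2` (`Hom((Fin r → E(ℚ_{∞,v})), ℤ₂)` through the transport `Θ`) is a
`ℤ₂`-module only, so the four-term duality algebra runs over `A := ℤ₂`, `K := ℚ₂`; the entry theorem `LambdaLowerBoundO.cmLambdaLower_of_finrank_characterModule`
(p666435) wants `d + Σ ≤ dim_{Frac 𝒪}(Frac 𝒪 ⊗_𝒪 Sg⋆)`. The bridge is (G1) `dim_{ℚ₂}(ℚ₂ ⊗_{ℤ₂} M) = [F:ℚ₂] · dim_{Frac 𝒪}(Frac 𝒪 ⊗_𝒪 M)`.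

* §1 `isLocalizedModule_baseChange_restrictScalars`, **`finrank_baseChange_eq_mul`** (G1), `finite_baseChange_iff` (G1b), `le_of_mul_le_finrank_baseChange`
  (G2), `finrank_fractionField_eq_finrank` (G1c: `[K:F] = rank_R A`), `finrank_baseChange_eq_finrank_mul` (G1d), `finiteDimensional_fractionField` (G1e).
* §2 `isScalarTower_characterModule`.
* §3 **`le_finrank_baseChange_characterModule_of_intDuality_decorated`** (G3) / `…_of_intDuality` (G3′): the N5 bound
  `CharIdealLambda.le_finrank_baseChange_characterModule_of_duality[_decorated]` with (EH_Z)/(ORTH)/(DH)/counts over `R` and the conclusion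
  `d ≤ dim_K (K ⊗_A Sel⋆)` over `A`.

References: [Kobayashi2003] Thm. 7.3 ((7.21), p. 13); [MilneADT2006] Ch. I Thm. 4.10; [Washington1997] §13.2 (λ as a rank).
-/

set_option autoImplicit false
set_option linter.dupNamespace false

noncomputable section

open scoped TensorProduct nonZeroDivisors

namespace Summit.BirchSwinnertonDyer.BirchSwinnertonDyer.Theorems.CharIdealLambda.IntDescent

open Summit.BirchSwinnertonDyer.BirchSwinnertonDyer.Theorems

universe u v w

/-! ## §1 Coefficient descent for `λ`: `dim_F (F ⊗_R M) = [K:F] · dim_K (K ⊗_A M)` -/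

section Descent

variable {R : Type*} [CommRing R] [IsDomain R] {A : Type*} [CommRing A] [IsDomain A] [Algebra R A]
  (F : Type*) [Field F] [Algebra R F] [IsFractionRing R F]
  (K : Type*) [Field K] [Algebra A K] [IsFractionRing A K] [Algebra R K] [IsScalarTower R A K]
  {M : Type*} [AddCommGroup M] [Module A M] [Module R M] [IsScalarTower R A M]

/-- **`K ⊗_A M` is ALSO the localisation of `M` at the non-zero elements of the SMALL ring `R`** (every non-zero
element of the algebraic extension `A` divides a non-zero element of `R`). [folklore] -/
theorem isLocalizedModule_baseChange_restrictScalars [FaithfulSMul R A] [Algebra.IsAlgebraic R A] :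
    IsLocalizedModule R⁰ ((TensorProduct.mk A K M 1).restrictScalars R) where
  map_units x := by
    have hx : algebraMap R K (x : R) ≠ 0 := by
      rw [IsScalarTower.algebraMap_apply R A K]
      exact IsFractionRing.to_map_ne_zero_of_mem_nonZeroDivisors
        (mem_nonZeroDivisors_of_ne_zero
          ((map_ne_zero_iff _ (FaithfulSMul.algebraMap_injective R A)).2 (nonZeroDivisors.coe_ne_zero x)))
    rw [Module.End.isUnit_iff]
    have hfun : ∀ y : K ⊗[A] M, algebraMap R (Module.End R (K ⊗[A] M)) (x : R) y = algebraMap R K (x : R) • y :=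
      fun y ↦ by rw [Module.algebraMap_end_apply, algebraMap_smul]
    constructor
    · intro y₁ y₂ h
      have h' : algebraMap R K (x : R) • y₁ = algebraMap R K (x : R) • y₂ := by rwa [← hfun, ← hfun]
      exact smul_right_injective _ hx h'
    · intro y
      exact ⟨(algebraMap R K (x : R))⁻¹ • y, by rw [hfun, smul_inv_smul₀ hx]⟩
  surj y := by
    obtain ⟨⟨m, a⟩, h⟩ := IsLocalizedModule.surj A⁰ (TensorProduct.mk A K M 1) y
    obtain ⟨r, hr, b, hb⟩ := (Algebra.IsAlgebraic.isAlgebraic (R := R) (a : A)).exists_nonzero_dvd a.2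
    refine ⟨⟨b • m, ⟨r, mem_nonZeroDivisors_of_ne_zero hr⟩⟩, ?_⟩
    have h' : (a : A) • y = (1 : K) ⊗ₜ[A] m := h
    change (r : R) • y = (1 : K) ⊗ₜ[A] (b • m)
    rw [← algebraMap_smul A r y, hb, mul_comm, mul_smul, h', TensorProduct.smul_tmul', TensorProduct.smul_tmul]
  exists_of_eq {m₁ m₂} h := by
    obtain ⟨a, ha⟩ := IsLocalizedModule.exists_of_eq (S := A⁰) (f := TensorProduct.mk A K M 1) (by exact h)
    obtain ⟨r, hr, b, hb⟩ := (Algebra.IsAlgebraic.isAlgebraic (R := R) (a : A)).exists_nonzero_dvd a.2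
    refine ⟨⟨r, mem_nonZeroDivisors_of_ne_zero hr⟩, ?_⟩
    have ha' : (a : A) • m₁ = (a : A) • m₂ := ha
    change (r : R) • m₁ = (r : R) • m₂
    rw [← algebraMap_smul A r m₁, ← algebraMap_smul A r m₂, hb, mul_comm, mul_smul, mul_smul, ha']

variable [Algebra F K] [IsScalarTower R F K]

/-- **(G1) COEFFICIENT DESCENT FOR λ.** `R → A` an algebraic extension of domains (`ℤ₂ → 𝒪`), `F → K` their fraction
fields (`ℚ₂ → K_ι`), `M` any `A`-module: `dim_F (F ⊗_R M) = [K:F] · dim_K (K ⊗_A M)`.  Proof: both sides of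
`F ⊗_R M ≅ K ⊗_A M` are the localisation of `M` at `R ∖ 0` (`isLocalizedModule_baseChange_restrictScalars`), the
isomorphism is `F`-linear (`extendScalarsOfIsLocalization`; `F` acts on `K ⊗_A M` through the left factor), then the tower law.
[folklore] -/
theorem finrank_baseChange_eq_mul [FaithfulSMul R A] [Algebra.IsAlgebraic R A] :
    Module.finrank F (F ⊗[R] M) = Module.finrank F K * Module.finrank K (K ⊗[A] M) := by
  haveI := isLocalizedModule_baseChange_restrictScalars (R := R) (A := A) K (M := M)
  let e : F ⊗[R] M ≃ₗ[F] K ⊗[A] M :=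
    (IsLocalizedModule.linearEquiv R⁰ (TensorProduct.mk R F M 1)
      ((TensorProduct.mk A K M 1).restrictScalars R)).extendScalarsOfIsLocalization R⁰ F
  rw [e.finrank_eq]
  exact (Module.finrank_mul_finrank F K (K ⊗[A] M)).symm

/-- **(G1b) finiteness transfers both ways** (`[K:F] < ∞`): `F ⊗_R M` is finite-dimensional over `F` iff `K ⊗_A M` is
over `K`. [folklore] -/
theorem finite_baseChange_iff [FaithfulSMul R A] [Algebra.IsAlgebraic R A] [FiniteDimensional F K] :
    Module.Finite F (F ⊗[R] M) ↔ Module.Finite K (K ⊗[A] M) := by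
  haveI := isLocalizedModule_baseChange_restrictScalars (R := R) (A := A) K (M := M)
  let e : F ⊗[R] M ≃ₗ[F] K ⊗[A] M :=
    (IsLocalizedModule.linearEquiv R⁰ (TensorProduct.mk R F M 1)
      ((TensorProduct.mk A K M 1).restrictScalars R)).extendScalarsOfIsLocalization R⁰ F
  constructor
  · intro hF
    haveI : Module.Finite F (K ⊗[A] M) := Module.Finite.equiv e
    exact Module.Finite.of_restrictScalars_finite F K (K ⊗[A] M)
  · intro hK
    haveI : Module.Finite F (K ⊗[A] M) := Module.Finite.trans K (K ⊗[A] M)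
    exact Module.Finite.equiv e.symm

/-- **(G2) the division step**: an `F`-currency bound with the exponent multiplied by `n = [K:F]` IS the `K`-currency
bound. [folklore] -/
theorem le_of_mul_le_finrank_baseChange [FaithfulSMul R A] [Algebra.IsAlgebraic R A] [FiniteDimensional F K] {m : ℕ}
    (h : Module.finrank F K * m ≤ Module.finrank F (F ⊗[R] M)) :
    m ≤ Module.finrank K (K ⊗[A] M) := by
  rw [finrank_baseChange_eq_mul (R := R) (A := A) F K (M := M)] at h
  exact Nat.le_of_mul_le_mul_left h Module.finrank_pos


/-- **(G1c) the degree of the fraction-field extension is the rank of the integral one** (`A` free of finite rank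
over `R`): `[K:F] = rank_R A` — G1 with `M := A`. [folklore] -/
theorem finrank_fractionField_eq_finrank [FaithfulSMul R A] [Module.Free R A] [Module.Finite R A] :
    Module.finrank F K = Module.finrank R A := by
  haveI : Algebra.IsIntegral R A := Algebra.IsIntegral.of_finite R A
  have h := finrank_baseChange_eq_mul (R := R) (A := A) F K (M := A)
  rw [Module.finrank_baseChange, (TensorProduct.AlgebraTensorModule.rid A K K).finrank_eq, Module.finrank_self,
    mul_one] at h
  exact h.symm

/-- **(G1d) = θ3 `FinrankRestrictScalars` of `Sketch_cruxidea2_g5.lean`, PROVED**: for `A` module-finite free and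
faithful over the domain `R` and ANY `A`-module `M`, `dim_F (F ⊗_R M) = rank_R A · dim_K (K ⊗_A M)`
(`λ_{ℤ₂} = [𝒪:ℤ₂] · λ_𝒪`). [folklore] -/
theorem finrank_baseChange_eq_finrank_mul [FaithfulSMul R A] [Module.Free R A] [Module.Finite R A] :
    Module.finrank F (F ⊗[R] M) = Module.finrank R A * Module.finrank K (K ⊗[A] M) := by
  haveI : Algebra.IsIntegral R A := Algebra.IsIntegral.of_finite R A
  rw [← finrank_fractionField_eq_finrank (R := R) (A := A) F K]
  exact finrank_baseChange_eq_mul (R := R) (A := A) F K (M := M)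

/-- **(G1e) consumer convenience**: the fraction-field extension `K/F` IS finite-dimensional as soon as `A` is free of
finite rank and faithful over `R` (discharges the `[FiniteDimensional F K]` binder of G1b/G2/G3 at
`R := ℤ_[2]`, `A := 𝒪`, from `GreenbergSelmer.moduleFree/moduleFinite_padicCoeffIntegers` + `faithfulSMul_padicInt`). [folklore] -/
theorem finiteDimensional_fractionField [FaithfulSMul R A] [Module.Free R A] [Module.Finite R A] :
    FiniteDimensional F K := by
  haveI : Module.IsTorsionFree R A :=
    Module.isTorsionFree_iff_algebraMap_injective.2 (FaithfulSMul.algebraMap_injective R A)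
  have h : 0 < Module.finrank F K := by
    rw [finrank_fractionField_eq_finrank (R := R) (A := A) F K]
    exact Module.finrank_pos
  exact Module.finite_of_finrank_pos h

end Descent

/-! ## §2 The two scalar structures on a Pontryagin dual form a tower -/

/-- Mathlib's `R`-structure `(r•φ)(s) = φ(r•s)` and `A`-structure on `CharacterModule Sel` form a scalar tower when
`R → A → Sel` does. [folklore] -/
theorem isScalarTower_characterModule {R : Type*} [CommRing R] {A : Type*} [CommRing A] [Algebra R A]
    {Sel : Type*} [AddCommGroup Sel] [Module A Sel] [Module R Sel] [IsScalarTower R A Sel] :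
    IsScalarTower R A (CharacterModule Sel) :=
  ⟨fun r a φ ↦ CharacterModule.ext _ fun s ↦ by
    simp only [CharacterModule.smul_apply]
    rw [smul_assoc, smul_comm a r s]⟩

/-! ## §3 The ℤ₂-descent cut, glued: duality data over `R`, conclusion over `A` -/

section Cut

variable {R : Type u} [CommRing R] [IsDomain R] {A : Type u} [CommRing A] [IsDomain A] [Algebra R A]
  [FaithfulSMul R A] [Algebra.IsAlgebraic R A]
  (F : Type u) [Field F] [Algebra R F] [IsFractionRing R F]
  (K : Type u) [Field K] [Algebra A K] [IsFractionRing A K] [Algebra R K] [IsScalarTower R A K]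
  [Algebra F K] [IsScalarTower R F K] [FiniteDimensional F K]
  {Sel : Type v} [AddCommGroup Sel] [Module A Sel] [Module R Sel] [IsScalarTower R A Sel]
  {P : Type v} [AddCommGroup P] [Module R P]
  {H : Type v} [AddCommGroup H] [Module R H]
  {H2 : Type v} [AddCommGroup H2] [Module R H2]
  (pair : P →ₗ[R] CharacterModule Sel) (locd : H →ₗ[R] P) (Z : Submodule R H) (Sel₀ : Submodule R Sel)

/-- **(G3) THE ℤ₂-DESCENT CUT, GLUED.** The N5 duality data typed over the SMALL ring `R` (= ℤ₂): an `R`-linear local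
pairing `pair : P → Sel⋆` (`P` = `n` Θ-coordinates of W's compact plus side, `R`-module only), `R`-linear `locd`, the zeta
span `Z` viewed over `R`, the strict submodule `Sel₀` over `R`, (EH_Z), (ORTH), (DH) with an `R`-scalar (`2^m`), and
the λ-inputs in `F`-currency with exponents MULTIPLIED by `n = [K:F]` — `n·d + e' ≤ λ_F(P/locd Z)` (Coleman value, via
G1 from the `𝒪`-side HOLD (i)), `λ_F(H/Z) ≤ λ_F(H2) + e'` (BT26 via G1), `λ_F(H2) ≤ λ_F(Sel₀⋆)` (compact PT over ℤ₂) —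
give the `𝒪`-currency conclusion `d ≤ dim_K (K ⊗_A Sel⋆)` of the entry theorem's `hlam`.  Proof: the landed N5 theorem
AT `A := R`, then G1 on `M := Sel⋆` and division by `n`. [cite: Kobayashi2003, Thm. 7.3 ((7.21), p. 13)]
[cite: MilneADT2006, Ch. I, Thm. 4.10] -/
theorem le_finrank_baseChange_characterModule_of_intDuality_decorated
    (hEH : ∀ z ∈ Z, pair (locd z) = 0) (horth : ∀ s ∈ Sel₀, ∀ z : P, pair z s = 0)
    (hDH : ∀ z : P, pair z = 0 → ∃ r : R, r ≠ 0 ∧ ∃ x : H, r • z = locd x)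
    [Module.Finite F (F ⊗[R] (H ⧸ Z))] [Module.Finite F (F ⊗[R] (P ⧸ Z.map locd))]
    [Module.Finite K (K ⊗[A] CharacterModule Sel)] {d e' : ℕ}
    (hi : Module.finrank F K * d + e' ≤ Module.finrank F (F ⊗[R] (P ⧸ Z.map locd)))
    (hii : Module.finrank F (F ⊗[R] (H ⧸ Z)) ≤ Module.finrank F (F ⊗[R] H2) + e')
    (hPT : Module.finrank F (F ⊗[R] H2) ≤ Module.finrank F (F ⊗[R] CharacterModule Sel₀)) :
    d ≤ Module.finrank K (K ⊗[A] CharacterModule Sel) := by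
  haveI : IsScalarTower R A (CharacterModule Sel) := isScalarTower_characterModule
  haveI : Module.Finite F (F ⊗[R] CharacterModule Sel) :=
    (finite_baseChange_iff F K (R := R) (A := A) (M := CharacterModule Sel)).2 inferInstance
  have h : Module.finrank F K * d ≤ Module.finrank F (F ⊗[R] CharacterModule Sel) :=
    CharIdealLambda.le_finrank_baseChange_characterModule_of_duality_decorated F pair locd Z Sel₀ hEH horth hDH
      hi hii hPT
  exact le_of_mul_le_finrank_baseChange F K h

/-- **(G3′) undecorated** (`e' = 0`, flank given directly). [cite: Kobayashi2003, Thm. 7.3 ((7.21), p. 13)] -/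
theorem le_finrank_baseChange_characterModule_of_intDuality
    (hEH : ∀ z ∈ Z, pair (locd z) = 0) (horth : ∀ s ∈ Sel₀, ∀ z : P, pair z s = 0)
    (hDH : ∀ z : P, pair z = 0 → ∃ r : R, r ≠ 0 ∧ ∃ x : H, r • z = locd x)
    [Module.Finite F (F ⊗[R] (H ⧸ Z))] [Module.Finite F (F ⊗[R] (P ⧸ Z.map locd))]
    [Module.Finite K (K ⊗[A] CharacterModule Sel)] {d : ℕ}
    (hm : Module.finrank F K * d ≤ Module.finrank F (F ⊗[R] (P ⧸ Z.map locd)))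
    (hflank : Module.finrank F (F ⊗[R] (H ⧸ Z)) ≤ Module.finrank F (F ⊗[R] CharacterModule Sel₀)) :
    d ≤ Module.finrank K (K ⊗[A] CharacterModule Sel) := by
  haveI : IsScalarTower R A (CharacterModule Sel) := isScalarTower_characterModule
  haveI : Module.Finite F (F ⊗[R] CharacterModule Sel) :=
    (finite_baseChange_iff F K (R := R) (A := A) (M := CharacterModule Sel)).2 inferInstance
  have h : Module.finrank F K * d ≤ Module.finrank F (F ⊗[R] CharacterModule Sel) :=
    CharIdealLambda.le_finrank_baseChange_characterModule_of_duality F pair locd Z Sel₀ hEH horth hDH hm hflank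
  exact le_of_mul_le_finrank_baseChange F K h

end Cut

end Summit.BirchSwinnertonDyer.BirchSwinnertonDyer.Theorems.CharIdealLambda.IntDescent

end
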